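import Mathlib
import Literature.MathematicalPhysics.QuantumFieldTheory.Balaban1983to89.B13Ineq230Printed

/-!
# `Balaban1983to89.B13Ineq230DoubleStar` — T. Bałaban, *Renormalization group approach to lattice gauge field
theories. II. Cluster expansions*, Commun. Math. Phys. **116** (1988) 1–22 [Balaban1988RG2Cluster]: the lower half
of (2.30) p. 18 at a NON-degenerate localization domain — the double star, d_k = 1 with 2^{d+1} − 1 cubes — REFUTED
AS PRINTED for d ≥ 4 under the sup-metric reading of the linear size (companion of `…B13Ineq230Printed`)

statement-level skeleton of published theorems with citation tags; proofs where landed; nothing here is a claim about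
the Yang–Mills mass gap

PDF held: `paper:balaban1988-cmp116-rg-ii-cluster` (journal page = PDF page + 0; p. 18 (2.30) and p. 8 re-read this
session from the text layer; verbatim quotations in `…B13Ineq230Printed` and `…TreeLength`).

CITATION HEADER / WHAT IS REPRODUCED (unit `lit-balaban-r10` gen 4, B13 fold owner; SKELETON row `B13.Eq2.30` of
`HOME/lit-balaban-r10/ROWS-B13.md`; HOME = `run/shared/lean/pub/lit-balaban/`).  (2.30) p. 18: *"(3·2³)⁻¹M⁻⁴|Y| ≦
d_k(Y) ≦ M⁻⁴|Y| − 1 (2.30) holding for localization domains Y ∈ 𝐃_k."*  The sibling `…B13Ineq230Printed` (p247110)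
types the display, refutes its lower half at DEGENERATE domains (d_k = 0: one cube, two cubes with a common wall —
metric-independent) and proves, for d_k(Y) ≥ 1, the printed SHAPE with the constant 5·2^d, leaving open whether the
printed 3·2³ survives at non-degenerate domains.  This file settles that question for the tree's reading of d_k
(`…Balaban1983to89.TreeLength`: polygonal graphs, closed unit cubes, Mathlib's SUP METRIC on ℝ^d after
[Dimock2013BalabanII] App. E — [Balaban1987RG1] p. 257 does not name the metric, cell DIVERGENCE D-T2):
* `cornerBox p` = the 2^d cubes having the lattice point p as a vertex (face-connected: `faceConnected_cornerBox`);
  `doubleStar p` = `cornerBox p ∪ cornerBox (p + 𝟙)` — 2^{d+1} − 1 cubes (`card_doubleStar`), face-connected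
  (`faceConnected_doubleStar`, the two boxes share the cube p), with d_k = 1 EXACTLY for d ≥ 1 (`treeLen_doubleStar`:
  ≤ 1 by the admissible main diagonal of the cube p, whose endpoints p, p + 𝟙 are vertices of all the cubes; ≥ 1 by
  the capture lemma `TreeLength.le_lenIn_closedBall`, since an admissible graph meets the cubes p − 𝟙 and p + 𝟙, at
  sup-distance ≥ 1);
* `ineq230Lower_fails_at_doubleStar` (every d ≥ 4), `not_ineq230Lower_nondegenerate`,
  `ineq230Lower_fails_at_doubleStar_four`: on the concrete window system the double-star domain has d_k = 1 and
  cube count 2^{d+1} − 1 ≥ 31 > 24, so the printed lower half fails EVEN RESTRICTED TO d_k ≥ 1 (d = 4: 31/24 > 1).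
METRIC CAVEAT (recorded, not formalised — the tree has no Euclidean tree length): with the Euclidean length the same
diagonal measures √d (= 2 at d = 4) and this configuration is no counterexample (31 ≤ 48); whether 3·2³ is the right
Euclidean constant is not decided here.  Every use of the lower half in the paper ((1.28) p. 8, p. 19 after (2.31),
p. 20 before Lemma 3, p. 21 after (2.40)) goes through the ADDITIVE form |Y| ≤ c(1 + d_k(Y)), which the tree proves
(`TreeLength.card_le_treeLen`, `B13Ineq230Printed.ineq230Lower_repaired_sys`); conclusions are unaffected.  No named
fact is introduced (D-0026): three definitions with bodies (`cornerBox`, `doubleStar`, `dstar`) and theorems.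
-/

namespace Literature.MathematicalPhysics.QuantumFieldTheory.Balaban1983to89.B13Ineq230DoubleStar

open Literature.MathematicalPhysics.QuantumFieldTheory.Balaban1983to89
open Literature.MathematicalPhysics.QuantumFieldTheory.Balaban1983to89.B13ScaleTransfer
open Literature.MathematicalPhysics.QuantumFieldTheory.Balaban1983to89.TreeLength
open Literature.MathematicalPhysics.QuantumFieldTheory.Balaban1983to89.TreeLengthCubeSystem
open Literature.MathematicalPhysics.QuantumFieldTheory.Balaban1983to89.B13Ineq230Printed (count count_eq)

variable {d : ℕ}

/-! ## Part A. The corner box and the double star -/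

/-- The 2^d cubes of π_k having the lattice point p as a vertex (cube [x, x + 1]^d ∋ p iff x_i ∈ {p_i − 1, p_i}): a
union of cubes every two of which are joined by a chain of common walls ([Balaban1987RG1] p. 257).
[cite: Balaban1987RG1, p.257 (localization domains)] -/
def cornerBox (p : Pt d) : Finset (Pt d) := Fintype.piFinset fun i => ({p i - 1, p i} : Finset ℤ)

/-- Membership in `cornerBox p`, coordinatewise. [cite: Balaban1987RG1, p.257 (localization domains)] -/
theorem mem_cornerBox {p x : Pt d} : x ∈ cornerBox p ↔ ∀ i, x i = p i - 1 ∨ x i = p i := by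
  simp [cornerBox, Fintype.mem_piFinset]

/-- `cornerBox p` has 2^d cubes. [cite: Balaban1987RG1, p.257 (localization domains)] -/
theorem card_cornerBox (p : Pt d) : (cornerBox p).card = 2 ^ d := by
  rw [cornerBox, Fintype.card_piFinset,
    Finset.prod_congr rfl (fun i _ => Finset.card_pair (by omega : p i - 1 ≠ p i)),
    Finset.prod_const, Finset.card_univ, Fintype.card_fin]

/-- The cube of index p belongs to `cornerBox p`. [cite: Balaban1987RG1, p.257 (localization domains)] -/
theorem self_mem_cornerBox (p : Pt d) : p ∈ cornerBox p := mem_cornerBox.2 fun _ => Or.inr rfl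

/-- The cube of index p − 𝟙 belongs to `cornerBox p`. [cite: Balaban1987RG1, p.257 (localization domains)] -/
theorem sub_one_mem_cornerBox (p : Pt d) : p - 1 ∈ cornerBox p :=
  mem_cornerBox.2 fun i => Or.inl (by simp)

/-- The lattice point p (= `corner p`) lies in every (closed) cube of `cornerBox p`.
[cite: Balaban1987RG1, p.257 (localization domains)] -/
theorem corner_mem_cube_of_mem_cornerBox {p x : Pt d} (hx : x ∈ cornerBox p) : corner p ∈ cube x := by
  rw [mem_cube]
  intro i
  simp only [corner]
  rcases mem_cornerBox.1 hx i with h | h <;> rw [h] <;> push_cast <;> constructor <;> linarith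

/-- Every cube of `cornerBox p` is chain-connected to the cube p inside the box (flip the low coordinates one at a
time; each flip is a common-wall step). [folklore] -/
private theorem linked_cornerBox_self {p : Pt d} :
    ∀ (n : ℕ) (x : Pt d), x ∈ cornerBox p → (Finset.univ.filter fun i => x i ≠ p i).card = n →
      Linked (cornerBox p) x p := by
  intro n
  induction n with
  | zero =>
    intro x hx h0
    have hxp : x = p := by
      funext i
      by_contra hne
      have hi : i ∈ Finset.univ.filter fun i => x i ≠ p i := Finset.mem_filter.2 ⟨Finset.mem_univ _, hne⟩
      rw [Finset.card_eq_zero] at h0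
      rw [h0] at hi
      exact absurd hi (Finset.notMem_empty i)
    subst hxp
    exact Relation.ReflTransGen.refl
  | succ n ih =>
    intro x hx hcard
    obtain ⟨i, hi⟩ : (Finset.univ.filter fun i => x i ≠ p i).Nonempty := by
      rw [← Finset.card_pos, hcard]
      exact Nat.succ_pos n
    have hxi : x i ≠ p i := (Finset.mem_filter.1 hi).2
    have hxi' : x i = p i - 1 := (mem_cornerBox.1 hx i).resolve_right hxi
    set x' : Pt d := Function.update x i (x i + 1) with hx'
    have hx'i : x' i = p i := by
      rw [hx', Function.update_self, hxi']
      ring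
    have hx'mem : x' ∈ cornerBox p := by
      rw [mem_cornerBox]
      intro j
      by_cases hj : j = i
      · subst hj
        exact Or.inr hx'i
      · rw [hx', Function.update_of_ne hj]
        exact mem_cornerBox.1 hx j
    have hstep : Linked (cornerBox p) x x' := linked_of_stepIn ⟨hx, hx'mem, adj_update_add_one x i⟩
    have hcard' : (Finset.univ.filter fun j => x' j ≠ p j).card = n := by
      have hset : (Finset.univ.filter fun j => x' j ≠ p j) = (Finset.univ.filter fun j => x j ≠ p j).erase i := by
        ext j
        simp only [Finset.mem_filter, Finset.mem_univ, true_and, Finset.mem_erase]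
        by_cases hj : j = i
        · subst hj
          simp [hx'i]
        · rw [hx', Function.update_of_ne hj]
          exact ⟨fun h => ⟨hj, h⟩, fun h => h.2⟩
      rw [hset, Finset.card_erase_of_mem hi, hcard]
      rfl
    exact hstep.trans (ih x' hx'mem hcard')

/-- `cornerBox p` is face-connected: a localization domain. [cite: Balaban1987RG1, p.257 (localization domains)] -/
theorem faceConnected_cornerBox (p : Pt d) : FaceConnected (cornerBox p) := fun x hx y hy =>
  (linked_cornerBox_self _ x hx rfl).trans (linked_cornerBox_self _ y hy rfl).symm

/-- THE DOUBLE STAR: the cubes having p as a vertex together with the cubes having p + 𝟙 as a vertex — two corner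
boxes sharing the single cube [p, p + 1]^d, whose main diagonal joins p to p + 𝟙.
[cite: Balaban1987RG1, p.257 (localization domains)] -/
def doubleStar (p : Pt d) : Finset (Pt d) := cornerBox p ∪ cornerBox (p + 1)

/-- The two corner boxes of the double star share exactly the cube p. [cite: Balaban1987RG1, p.257 (localization domains)] -/
theorem cornerBox_inter (p : Pt d) : cornerBox p ∩ cornerBox (p + 1) = {p} := by
  ext x
  simp only [Finset.mem_inter, mem_cornerBox, Finset.mem_singleton, Pi.add_apply, Pi.one_apply]
  constructor
  · rintro ⟨h1, h2⟩
    funext i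
    rcases h1 i with a | a <;> rcases h2 i with b | b <;> omega
  · rintro rfl
    exact ⟨fun i => Or.inr rfl, fun i => Or.inl (by ring)⟩

/-- The double star has M⁻⁴|Y| = 2^{d+1} − 1 cubes (d = 4: 31). [cite: Balaban1988RG2Cluster, (2.30) p.18] -/
theorem card_doubleStar (p : Pt d) : (doubleStar p).card = 2 ^ (d + 1) - 1 := by
  have h := Finset.card_union_add_card_inter (cornerBox p) (cornerBox (p + 1))
  rw [cornerBox_inter, Finset.card_singleton, card_cornerBox, card_cornerBox] at h
  rw [doubleStar, pow_succ]
  omega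

/-- The double star is face-connected: a localization domain. [cite: Balaban1987RG1, p.257 (localization domains)] -/
theorem faceConnected_doubleStar (p : Pt d) : FaceConnected (doubleStar p) :=
  B13Ineq232.faceConnected_union (faceConnected_cornerBox p) (faceConnected_cornerBox (p + 1))
    ⟨p, by rw [cornerBox_inter]; exact Finset.mem_singleton_self p⟩

/-- The cube p belongs to the double star. [cite: Balaban1987RG1, p.257 (localization domains)] -/
theorem self_mem_doubleStar (p : Pt d) : p ∈ doubleStar p :=
  Finset.mem_union_left _ (self_mem_cornerBox p)

/-! ## Part B. d_k(double star) = 1 -/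

/-- The main diagonal of the cube p — the segment from p to p + 𝟙, of sup-length 1 (0 if d = 0) — is an admissible
graph for the double star: it lies in the cube p and its endpoints are vertices of all the cubes.
[cite: Balaban1987RG1, p.257 (linear size d_j)] -/
theorem admissible_doubleStar (p : Pt d) : Admissible (doubleStar p) [(corner p, corner (p + 1))] := by
  have hq : corner (p + 1) ∈ cube p := by
    rw [mem_cube]
    intro i
    simp only [corner, Pi.add_apply, Pi.one_apply]
    push_cast
    constructor <;> linarith
  refine ⟨?_, ?_, ?_⟩
  · simp only [carrier_cons, carrier_nil, Set.union_empty]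
    exact (convex_segment _ _).isConnected ⟨corner p, left_mem_segment ℝ _ _⟩
  · simp only [carrier_cons, carrier_nil, Set.union_empty]
    exact ((convex_cube p).segment_subset (corner_mem_cube p) hq).trans (cube_subset_cubes (self_mem_doubleStar p))
  · intro x hx
    rcases Finset.mem_union.1 hx with hx | hx
    · exact ⟨corner p, by simp [left_mem_segment], corner_mem_cube_of_mem_cornerBox hx⟩
    · exact ⟨corner (p + 1), by simp [right_mem_segment], corner_mem_cube_of_mem_cornerBox hx⟩

/-- d_k(double star) ≤ 1: the diagonal has sup-length ≤ 1. [cite: Balaban1987RG1, p.257 (linear size d_j)] -/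
theorem treeLen_doubleStar_le_one (p : Pt d) : treeLen (doubleStar p) ≤ 1 := by
  refine (treeLen_le_len (admissible_doubleStar p)).trans ?_
  simp only [len_cons, len_nil, add_zero]
  refine (dist_pi_le_iff zero_le_one).2 fun i => ?_
  simp only [corner, Pi.add_apply, Pi.one_apply, Real.dist_eq]
  push_cast
  rw [abs_le]
  constructor <;> linarith

/-- d_k(double star) ≥ 1 (d ≥ 1): an admissible graph meets the cube p − 𝟙 at a point P (P₀ ≤ p₀) and the cube
p + 𝟙 at a point Q (Q₀ ≥ p₀ + 1), so dist(P, Q) ≥ 1, and a connected graph through P reaching distance 1 has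
length ≥ 1 inside the ball B̄(P, 1) (`TreeLength.le_lenIn_closedBall`). [cite: Balaban1987RG1, p.257 (linear size d_j)] -/
theorem one_le_treeLen_doubleStar (hd : 0 < d) (p : Pt d) : 1 ≤ treeLen (doubleStar p) := by
  refine le_treeLen ⟨_, admissible_doubleStar p⟩ fun T hT => ?_
  obtain ⟨P, hPT, hPc⟩ := hT.meets (p - 1) (Finset.mem_union_left _ (sub_one_mem_cornerBox p))
  obtain ⟨Q, hQT, hQc⟩ := hT.meets (p + 1) (Finset.mem_union_right _ (self_mem_cornerBox (p + 1)))
  have hdist : 1 ≤ dist P Q := by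
    let i : Fin d := ⟨0, hd⟩
    have h1 := (mem_cube.1 hPc i).2
    have h2 := (mem_cube.1 hQc i).1
    simp only [Pi.sub_apply, Pi.add_apply, Pi.one_apply, Int.cast_sub, Int.cast_add, Int.cast_one] at h1 h2
    calc (1 : ℝ) ≤ dist (P i) (Q i) := by
          rw [Real.dist_eq]
          exact le_abs.2 (Or.inr (by linarith))
      _ ≤ dist P Q := dist_le_pi_dist P Q i
  have hcap := le_lenIn_closedBall hT.connected.isPreconnected hPT hQT one_pos hdist
  have hle : lenIn (Metric.closedBall P 1) T ≤ len T := by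
    have h := sum_lenIn_le_len ({0} : Finset ℕ) (fun _ => Metric.closedBall P 1)
      (fun _ _ => Metric.isClosed_closedBall)
      (by rw [Finset.coe_singleton]; exact Set.pairwiseDisjoint_singleton _ _) T
    simpa using h
  linarith

/-- d_k(double star) = 1 exactly (d ≥ 1, sup-metric reading of the linear size).
[cite: Balaban1987RG1, p.257 (linear size d_j)] -/
theorem treeLen_doubleStar (hd : 0 < d) (p : Pt d) : treeLen (doubleStar p) = 1 :=
  le_antisymm (treeLen_doubleStar_le_one p) (one_le_treeLen_doubleStar hd p)

/-! ## Part C. The printed lower half of (2.30) at the double star -/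

/-- The double star as a localization domain of a window B containing it. [cite: Balaban1987RG1, p.257 (localization domains)] -/
def dstar (B : Finset (Pt d)) (p : Pt d) (h : doubleStar p ⊆ B) : Dom B :=
  ⟨doubleStar p, h, ⟨p, self_mem_doubleStar p⟩, faceConnected_doubleStar p⟩

/-- The cubes of `dstar B p h` are the double star. [cite: Balaban1987RG1, p.257 (localization domains)] -/
@[simp] theorem dstar_val (B : Finset (Pt d)) (p : Pt d) (h : doubleStar p ⊆ B) : (dstar B p h).1 = doubleStar p :=
  rfl

/-- M⁻⁴|Y| of the double-star domain = 2^{d+1} − 1. [cite: Balaban1988RG2Cluster, (2.30) p.18] -/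
@[simp] theorem count_dstar (B : Finset (Pt d)) (p : Pt d) (h : doubleStar p ⊆ B) :
    count B (dstar B p h) = 2 ^ (d + 1) - 1 := by
  rw [count_eq, dstar_val, card_doubleStar]

/-- d_k of the double-star domain = 1 (d ≥ 1). [cite: Balaban1987RG1, p.257 (linear size d_j)] -/
@[simp] theorem dj_dstar (hd : 0 < d) (B : Finset (Pt d)) (p : Pt d) (h : doubleStar p ⊆ B) :
    (sys B).dj (dstar B p h) = 1 := by
  rw [sys_dj, dstar_val, treeLen_doubleStar hd]

/-- **(2.30) lower half fails at a NON-degenerate domain** in every dimension d ≥ 4 (sup-metric reading of d_k, the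
convention of `…Balaban1983to89.TreeLength` after [Dimock2013BalabanII] App. E): the double star has d_k = 1 and
M⁻⁴|Y| = 2^{d+1} − 1 ≥ 31 > 24 = 3·2³, so *"(3·2³)⁻¹M⁻⁴|Y| ≦ d_k(Y)"* reads 31/24 ≤ 1 at d = 4.  METRIC CAVEAT
(cell DIVERGENCE D-T2: [Balaban1987RG1] p. 257 does not name the metric of *"the length of a shortest graph"*): with
the Euclidean length the same diagonal measures √d (= 2 at d = 4) and this configuration is no counterexample
(31 ≤ 48); the degenerate failures of Part C (d_k = 0) hold for any metric.  So the printed constant 3·2³ is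
metric-sensitive at d_k ~ 1, while every use of the lower half in the paper goes through the additive form
(`B13Ineq230Printed.ineq230Lower_repaired_sys`). [cite: Balaban1988RG2Cluster, (2.30) p.18] -/
theorem ineq230Lower_fails_at_doubleStar (hd : 4 ≤ d) (B : Finset (Pt d)) (p : Pt d) (h : doubleStar p ⊆ B) :
    (sys B).dj (dstar B p h) = 1 ∧
      ¬ ((3 * 2 ^ 3 : ℝ)⁻¹ * (count B (dstar B p h) : ℝ) ≤ (sys B).dj (dstar B p h)) := by
  have hd0 : 0 < d := by omega
  refine ⟨dj_dstar hd0 B p h, ?_⟩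
  rw [dj_dstar hd0, count_dstar]
  have h32 : (32 : ℕ) ≤ 2 ^ (d + 1) := by
    calc (32 : ℕ) = 2 ^ (4 + 1) := by norm_num
      _ ≤ 2 ^ (d + 1) := Nat.pow_le_pow_right (by norm_num) (by omega)
  have h31 : (31 : ℝ) ≤ ((2 ^ (d + 1) - 1 : ℕ) : ℝ) := by
    have : (31 : ℕ) ≤ 2 ^ (d + 1) - 1 := by omega
    exact_mod_cast this
  intro hle
  have : (3 * 2 ^ 3 : ℝ)⁻¹ * 31 ≤ 1 := le_trans (by gcongr) hle
  norm_num at this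

/-- Hence, for d ≥ 4 and every window containing a double star, the printed lower half of (2.30) fails EVEN WHEN
RESTRICTED to the domains with d_k(Y) ≥ 1 — the regime of p. 8 *"we sum over X with d_j(X) ≠ 0"* (sup-metric
reading; see the metric caveat of `ineq230Lower_fails_at_doubleStar`).  What the tree proves in that regime is
`B13Ineq230Printed.ineq230Lower_of_one_le` (constant 5·2^d). [cite: Balaban1988RG2Cluster, (2.30) p.18] -/
theorem not_ineq230Lower_nondegenerate (hd : 4 ≤ d) (B : Finset (Pt d)) (p : Pt d) (h : doubleStar p ⊆ B) :
    ¬ (∀ Y : (sys B).Dom, 1 ≤ (sys B).dj Y → (3 * 2 ^ 3 : ℝ)⁻¹ * (count B Y : ℝ) ≤ (sys B).dj Y) := by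
  intro hall
  obtain ⟨h1, hfail⟩ := ineq230Lower_fails_at_doubleStar hd B p h
  exact hfail (hall (dstar B p h) (le_of_eq h1.symm))

/-- In particular in the paper's dimension d = 4 the double star is a localization domain with d_k = 1 and 31 cubes,
and 31/24 > 1. [cite: Balaban1988RG2Cluster, (2.30) p.18] -/
theorem ineq230Lower_fails_at_doubleStar_four (B : Finset (Pt 4)) (p : Pt 4) (h : doubleStar p ⊆ B) :
    (sys B).dj (dstar B p h) = 1 ∧ count B (dstar B p h) = 31 ∧
      ¬ ((3 * 2 ^ 3 : ℝ)⁻¹ * (count B (dstar B p h) : ℝ) ≤ (sys B).dj (dstar B p h)) := by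
  obtain ⟨h1, h2⟩ := ineq230Lower_fails_at_doubleStar le_rfl B p h
  exact ⟨h1, by rw [count_dstar]; norm_num, h2⟩

end Literature.MathematicalPhysics.QuantumFieldTheory.Balaban1983to89.B13Ineq230DoubleStar
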